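import Summits.ResolutionOfSingularities.ResolutionOfSingularities.Theorems.FrobeniusLadderFRationalResolutionGradedDegreeZeroFinite
import Summits.ResolutionOfSingularities.ResolutionOfSingularities.Theorems.FrobeniusLadderFRationalResolutionCompletionDomain
import HarnessLib

/-!
# Crux `FrobeniusLadder.FRationalResolution` (stmt-ResolutionOfSingularities-15317), line `redirect`,
# stub `stub_diagonalizableQuotientResolution` — `hfin` AT A TWISTED POINT FROM A WEIGHT-ZERO EMBEDDING `Ê ↪ κ[[y₁,…,yₙ]]`

The `hfin` hypothesis of `…CompletionDomain.hloc_of_traceIdealCentre_then_finite_singularPoints_of_isIntegrallyClosed` (p840173) — finiteness of the set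
`𝒯` of trace ideals of the nonzero divisorial ideals of `Ê = ((B ⊗_K K')_{𝔔'})^` — in the form the toric dictionary can supply: it holds as soon as
`Ê` embeds into a power series ring `κ[[y₁,…,yₙ]]` with image the series supported on the monomials of weight `0` for some weights
`w : Fin n → ℤ/r` (`…GradedDegreeZeroFinite.finite_traceIdeals_divisorial_mvPowerSeries`, p840330; `Ê` is a Noetherian integrally closed domain at a
normal point, p840173).

★★ `hfin_of_weightZero_embedding`. What remains class-specific for (α′): the embedding itself (Luna/Kato: the complete local ring of a diagonalizable
quotient singularity at a split point is the invariant ring `κ[[y]]^{μ}` = weight-zero part) and one non-principal divisorial ideal.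
Honest label: assembly toward ONE leaf stub (no stub, crux or summit closed). No definitions, no named facts, no sorry.
[folklore; cite: BrunsHerzog1993, §1.5] [cite: StacksProject, Tag 0C23]
-/

noncomputable section

-- single-problem summit: the doubled namespace component is forced
set_option linter.dupNamespace false

open CategoryTheory AlgebraicGeometry TopologicalSpace IsLocalRing TensorProduct
open Literature.AlgebraicGeometry.Resolution
open Summit.ResolutionOfSingularities.ResolutionOfSingularities.Theorems.FRationalResolution

namespace Summit.ResolutionOfSingularities.ResolutionOfSingularities.Theorems.FRationalResolution.TraceIdealsFiniteOfEmbedding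

/-- ★★ **`hfin` from a weight-zero embedding.** `B` an integrally closed domain of finite type over `K`, `K'/K` finite separable, `𝔔'` a prime of
`B ⊗_K K'`, `Ê = ((B ⊗_K K')_{𝔔'})^`; if `Ê` embeds into `κ[[y₁,…,yₙ]]` onto the weight-zero power series for weights `w : Fin n → ℤ/r` (`r ≠ 0`),
then the set of trace ideals of the nonzero divisorial ideals of `Ê` is finite. [folklore; cite: BrunsHerzog1993, §1.5] [cite: StacksProject, Tag 0C23] -/
theorem hfin_of_weightZero_embedding (K : Type) [Field K] {B : Type} [CommRing B] [IsDomain B] [IsIntegrallyClosed B] [Algebra K B]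
    [Algebra.FiniteType K B] (K' : Type) [Field K'] [Algebra K K'] [FiniteDimensional K K'] [Algebra.IsSeparable K K']
    (𝔔' : Ideal (B ⊗[K] K')) [𝔔'.IsPrime]
    (κ : Type) [Field κ] (n r : ℕ) [NeZero r] (w : Fin n → ZMod r)
    (φ : AdicCompletion (maximalIdeal (Localization.AtPrime 𝔔')) (Localization.AtPrime 𝔔') →+* MvPowerSeries (Fin n) κ)
    (hφ : Function.Injective φ)
    (himage : ∀ f : MvPowerSeries (Fin n) κ,
      (∃ x, φ x = f) ↔ ∀ m : Fin n →₀ ℕ, MvPowerSeries.coeff m f ≠ 0 → Finsupp.weight w m = 0) :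
    Set.Finite {T : Ideal (AdicCompletion (maximalIdeal (Localization.AtPrime 𝔔')) (Localization.AtPrime 𝔔')) |
      ∃ I : Ideal (AdicCompletion (maximalIdeal (Localization.AtPrime 𝔔')) (Localization.AtPrime 𝔔')),
        (I ≠ ⊥ ∧ ∀ x, (∀ a b, (∀ y ∈ I, b * y ∈ Ideal.span {a}) → b * x ∈ Ideal.span {a}) → x ∈ I) ∧
        T = ⨆ ψ : I →ₗ[AdicCompletion (maximalIdeal (Localization.AtPrime 𝔔')) (Localization.AtPrime 𝔔')]
          AdicCompletion (maximalIdeal (Localization.AtPrime 𝔔')) (Localization.AtPrime 𝔔'), LinearMap.range ψ} := by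
  haveI : IsNoetherianRing B := Algebra.FiniteType.isNoetherianRing K B
  haveI : Algebra.FiniteType B (B ⊗[K] K') := inferInstance
  haveI : IsNoetherianRing (B ⊗[K] K') := Algebra.FiniteType.isNoetherianRing B (B ⊗[K] K')
  haveI : IsNoetherianRing (Localization.AtPrime 𝔔') :=
    IsLocalization.isNoetherianRing 𝔔'.primeCompl (Localization.AtPrime 𝔔') inferInstance
  haveI : IsNoetherianRing (AdicCompletion (maximalIdeal (Localization.AtPrime 𝔔')) (Localization.AtPrime 𝔔')) :=
    isNoetherianRing_adicCompletion_maximalIdeal _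
  obtain ⟨hdom, hic⟩ := CompletionDomain.isDomain_and_isIntegrallyClosed_adicCompletion_galois K K' 𝔔'
  haveI := hdom
  haveI := hic
  letI : Algebra (AdicCompletion (maximalIdeal (Localization.AtPrime 𝔔')) (Localization.AtPrime 𝔔')) (MvPowerSeries (Fin n) κ) :=
    φ.toAlgebra
  exact GradedDegreeZeroFinite.finite_traceIdeals_divisorial_mvPowerSeries κ n r w hφ himage

end Summit.ResolutionOfSingularities.ResolutionOfSingularities.Theorems.FRationalResolution.TraceIdealsFiniteOfEmbedding

end
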